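import Summits.PneNP.PneNP.Theses.NegLimited
import Literature.Computability.Complexity.MatchingSunflowers

/-!
# Route NegLimited — T5⁺ ⇒ T5: `GapPerfectMatchingExp → GapPerfectMatchingQuasipoly` (rung F-N1/p3, line r7-crosscut)

Registered stub `stub_quasipoly_of_exp` of the skeleton line `r7-crosscut` for item T5 =
`NegLimited.GapPerfectMatchingQuasipoly` (stmt-PneNP-19861; HOME/pnp-ideate-p3/Skeleton-R7-crosscut.lean,
sha 0079776e761d5a21). This file DECLARES the statement `GapPerfectMatchingExp` (T5⁺, the gap-robust
exponential monotone lower bound for perfect matching — new, not in print; copied verbatim from the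
cell's shared definitions file HOME/pnp-ideate-p3/turnkey-R8/NegLimitedGapPMDefs.lean into the shared
namespace `Summit.PneNP.PneNP.Theorems.NegLimitedGapPM`; later files of the line import it from here)
and proves the routine implication to the route item: with `δ = 1/12` the exponential bound
`2^{m^{1/4}}` dominates `m^{c log m} = exp(c log² m)` for `c = 1`, eventually in `m`
(`isLittleO_log_rpow_rpow_atTop`: `log² x = o(x^{1/4})`).
-/

set_option linter.dupNamespace false -- `Summit.PneNP.PneNP.…`: summit = sub-problem name (D-0017 single-conjunct layout)

namespace Summit.PneNP.PneNP.Theorems.NegLimitedGapPM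

open Finset Filter
open Literature.Computability.Complexity
open Literature.Computability.Complexity.PerfectMatching
open Literature.Barriers.PneNP (perfectMatchingFn)

/-- T5⁺: the gap-robust exponential perfect-matching lower bound (new theorem, not in print;
statement verbatim from the skeleton line `r7-crosscut`): for every gap `K ≥ 2` and `δ > 0`,
eventually every monotone circuit accepting all graphs with a perfect matching and rejecting all
`K`-deficient graphs has at least `2^{m^{1/3-δ}}` gates. -/
def GapPerfectMatchingExp : Prop :=
  ∀ K : ℕ, 2 ≤ K → ∀ δ : ℝ, 0 < δ → ∀ᶠ m : ℕ in atTop,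
    ∀ C : Circuit (Edge m), C.IsOver monotoneBasis →
      (∀ x, perfectMatchingFn m x = true → C.eval x = true) →
      (∀ x, (∀ D : Finset (Edge m), IsMatching D → (∀ e ∈ D, x e = true) → D.card + m / K ≤ m) →
        C.eval x = false) →
      (2 : ℝ) ^ ((m : ℝ) ^ (1 / 3 - δ)) ≤ C.size

/-- `m^{log m} ≤ 2^{m^{1/4}}` eventually (`log² m ≤ log 2 · m^{1/4}` from `log² x = o(x^{1/4})`). -/
theorem eventually_rpow_log_le_two_pow_rpow_quarter :
    ∀ᶠ m : ℕ in atTop, (m : ℝ) ^ (1 * Real.log m) ≤ (2 : ℝ) ^ ((m : ℝ) ^ (1 / 3 - 1 / 12 : ℝ)) := by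
  have hlo := (isLittleO_log_rpow_rpow_atTop (2 : ℝ) (by norm_num : (0 : ℝ) < 1 / 4)).bound
    (Real.log_pos one_lt_two)
  have hnat := tendsto_natCast_atTop_atTop.eventually hlo
  filter_upwards [hnat, eventually_ge_atTop 1] with m hb hm1
  have hm1r : (1 : ℝ) ≤ m := by exact_mod_cast hm1
  have hm0 : (0 : ℝ) < m := by linarith
  have hlog0 : 0 ≤ Real.log m := Real.log_nonneg hm1r
  rw [Real.norm_of_nonneg (Real.rpow_nonneg hlog0 _),
    Real.norm_of_nonneg (Real.rpow_nonneg hm0.le _), Real.rpow_two] at hb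
  rw [show (1 : ℝ) / 3 - 1 / 12 = 1 / 4 by norm_num, Real.rpow_def_of_pos hm0,
    Real.rpow_def_of_pos two_pos, Real.exp_le_exp]
  nlinarith [hb]

/-- **T5⁺ ⇒ T5**: the exponential gap bound implies the route item `GapPerfectMatchingQuasipoly`
(stmt-PneNP-19861) with `c = 1` for every `K` (take `δ = 1/12`). -/
theorem quasipoly_of_exp_holds :
    GapPerfectMatchingExp → Summit.PneNP.PneNP.Theses.NegLimited.GapPerfectMatchingQuasipoly := by
  intro h K hK
  refine ⟨1, one_pos, ?_⟩
  filter_upwards [h K hK (1 / 12) (by norm_num), eventually_rpow_log_le_two_pow_rpow_quarter]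
    with m hm hb C hC hacc hrej
  exact hb.trans (hm C hC hacc hrej)

/-- **Registered stub `stub_quasipoly_of_exp` of line `r7-crosscut`** (item stmt-PneNP-19861,
skeleton sha 0079776e761d5a21), by name. -/
theorem stub_quasipoly_of_exp :
    GapPerfectMatchingExp → Summit.PneNP.PneNP.Theses.NegLimited.GapPerfectMatchingQuasipoly :=
  quasipoly_of_exp_holds

end Summit.PneNP.PneNP.Theorems.NegLimitedGapPM
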